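import Mathlib.Topology.Algebra.OpenSubgroup
import Mathlib.Topology.Algebra.ClopenNhdofOne
import Literature.NumberTheory.GaloisRepresentations.TateProjectiveLiftingH2Proofs
import HarnessLib

/-!
# Locally constant `2`-cocycles on closed subgroups of a profinite group: extension and descent

Topic `GroupTheory` (profinite groups, explicit cochains); namespace
`Literature.GroupTheory.LocallyConstantCocycles`.  Proof file: theorems only (no definition, no
instance, no named fact).

`Γ` is a profinite group, `R` a commutative ring (discrete coefficients, TRIVIAL action), `H ≤ Γ` a
CLOSED subgroup.  Cochains are total functions on `Γ` restricted to a subgroup `S`: a `2`-cocycle on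
`S` is `f : Γ → Γ → R`, locally constant on `S × S`, with `f a b + f (a b) c = f b c + f a (b c)`
(`a b c ∈ S`; convention of `TateLocalH2Nonvanishing.lean`); a coboundary on `S` is
`f a b = β a + β b - β (a b)` for `β : Γ → R` locally constant on `S`.  Then
`H²(H, R) = colim_{V ⊇ H open} H²(V, R)` (Serre, I §2.2 Prop. 8), in the two explicit halves used by
Neukirch's characterisation of decomposition groups ([NeukirchSchmidtWingberg2008] XII §1):

* `exists_open_extension_of_cocycle` — SURJECTIVITY: a locally constant `2`-cocycle on `H` extends
  to a locally constant `2`-cocycle on some open `V₀ ⊇ H` (inside any given open `U ⊇ H`);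
* `exists_open_coboundary_of_coboundary` — INJECTIVITY: a locally constant `2`-cochain on an open
  `V ⊇ H` which bounds on `H` already bounds on some open `V'` with `H ≤ V' ≤ V`;
* `cocycle_conj_sub_coboundary` — inner automorphisms act trivially (explicit homotopy); coboundary
  algebra (`coboundary_mono`, `coboundary_smul`, `coboundary_add`, …).

## References

* J.-P. Serre, *Galois Cohomology* (1997), I §2.2 Prop. 8. [SerreGaloisCohomology1997]
* J. Neukirch, A. Schmidt, K. Wingberg, *Cohomology of Number Fields* (2008), I §2, XII §1.
  [NeukirchSchmidtWingberg2008]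
-/

open Topology
open scoped Pointwise

universe u v w

namespace Literature.GroupTheory.LocallyConstantCocycles

open Literature.NumberTheory.GaloisRepresentations

variable {Γ : Type u} [Group Γ] [TopologicalSpace Γ]
variable {R : Type v} [CommRing R]

/-! ### Algebra of coboundaries on a subgroup -/

section Algebra
/-- A coboundary on `S` restricts to a coboundary on any `T ≤ S` (restriction of cochains,
Serre I §2.2). [cite: SerreGaloisCohomology1997, I §2.2] -/
theorem coboundary_mono {S T : Subgroup Γ} (hTS : T ≤ S) {f : Γ → Γ → R}
    (h : ∃ β : Γ → R, IsLocallyConstant (fun s : S => β s) ∧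
      ∀ a ∈ S, ∀ b ∈ S, f a b = β a + β b - β (a * b)) :
    ∃ β : Γ → R, IsLocallyConstant (fun t : T => β t) ∧
      ∀ a ∈ T, ∀ b ∈ T, f a b = β a + β b - β (a * b) := by
  obtain ⟨β, hβ, hf⟩ := h
  refine ⟨β, ?_, fun a ha b hb => hf a (hTS ha) b (hTS hb)⟩
  exact hβ.comp_continuous (f := Subgroup.inclusion hTS)
    (Continuous.subtype_mk continuous_subtype_val _)

/-- Scalar multiples of coboundaries are coboundaries (the coboundaries form a submodule,
Serre I §2.2). [cite: SerreGaloisCohomology1997, I §2.2] -/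
theorem coboundary_smul {S : Subgroup Γ} (c : R) {f : Γ → Γ → R}
    (h : ∃ β : Γ → R, IsLocallyConstant (fun s : S => β s) ∧
      ∀ a ∈ S, ∀ b ∈ S, f a b = β a + β b - β (a * b)) :
    ∃ β : Γ → R, IsLocallyConstant (fun s : S => β s) ∧
      ∀ a ∈ S, ∀ b ∈ S, c * f a b = β a + β b - β (a * b) := by
  obtain ⟨β, hβ, hf⟩ := h
  refine ⟨fun g => c * β g, hβ.comp (fun x => c * x), fun a ha b hb => ?_⟩
  rw [hf a ha b hb]; ring

/-- If `c` is a unit and `c • f` is a coboundary, so is `f` (coboundaries form a submodule,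
Serre I §2.2). [cite: SerreGaloisCohomology1997, I §2.2] -/
theorem coboundary_of_smul_unit {S : Subgroup Γ} {c : R} (hc : IsUnit c) {f : Γ → Γ → R}
    (h : ∃ β : Γ → R, IsLocallyConstant (fun s : S => β s) ∧
      ∀ a ∈ S, ∀ b ∈ S, c * f a b = β a + β b - β (a * b)) :
    ∃ β : Γ → R, IsLocallyConstant (fun s : S => β s) ∧
      ∀ a ∈ S, ∀ b ∈ S, f a b = β a + β b - β (a * b) := by
  obtain ⟨d, hd⟩ := hc.exists_left_inv
  obtain ⟨β, hβ, hf⟩ := coboundary_smul (S := S) d h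
  refine ⟨β, hβ, fun a ha b hb => ?_⟩
  rw [← hf a ha b hb, ← mul_assoc, hd, one_mul]

/-- Sums of coboundaries are coboundaries (Serre I §2.2). [cite: SerreGaloisCohomology1997, I §2.2] -/
theorem coboundary_add {S : Subgroup Γ} {f g : Γ → Γ → R}
    (hf : ∃ β : Γ → R, IsLocallyConstant (fun s : S => β s) ∧
      ∀ a ∈ S, ∀ b ∈ S, f a b = β a + β b - β (a * b))
    (hg : ∃ β : Γ → R, IsLocallyConstant (fun s : S => β s) ∧
      ∀ a ∈ S, ∀ b ∈ S, g a b = β a + β b - β (a * b)) :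
    ∃ β : Γ → R, IsLocallyConstant (fun s : S => β s) ∧
      ∀ a ∈ S, ∀ b ∈ S, f a b + g a b = β a + β b - β (a * b) := by
  obtain ⟨β, hβ, hf⟩ := hf
  obtain ⟨γ, hγ, hg⟩ := hg
  refine ⟨fun x => β x + γ x, hβ.comp₂ hγ (· + ·), fun a ha b hb => ?_⟩
  rw [hf a ha b hb, hg a ha b hb]; ring

/-- The zero cochain is a coboundary (Serre I §2.2). [cite: SerreGaloisCohomology1997, I §2.2] -/
theorem coboundary_zero (S : Subgroup Γ) :
    ∃ β : Γ → R, IsLocallyConstant (fun s : S => β s) ∧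
      ∀ a ∈ S, ∀ b ∈ S, (0 : Γ → Γ → R) a b = β a + β b - β (a * b) :=
  ⟨0, IsLocallyConstant.const 0, fun a _ b _ => by simp⟩

omit [TopologicalSpace Γ] in
/-- **Inner automorphisms act trivially on `H²`** (explicit homotopy): for a `2`-cocycle `f` on `S`
and `u ∈ S`, the conjugate cocycle `(a, b) ↦ f (u⁻¹ a u, u⁻¹ b u)` differs from `f` by the
coboundary of `γ a = f (u, u⁻¹ a u) - f (a, u)`.  Serre, *Galois Cohomology*, I §2 (conjugation),
here with trivial coefficients. [cite: SerreGaloisCohomology1997, I §2.2 Prop. 8] -/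
theorem cocycle_conj_sub_coboundary {S : Subgroup Γ} {f : Γ → Γ → R}
    (hcoc : ∀ a ∈ S, ∀ b ∈ S, ∀ c ∈ S, f a b + f (a * b) c = f b c + f a (b * c))
    {u : Γ} (hu : u ∈ S) {a b : Γ} (ha : a ∈ S) (hb : b ∈ S) :
    f (u⁻¹ * a * u) (u⁻¹ * b * u) - f a b =
      (f u (u⁻¹ * a * u) - f a u) + (f u (u⁻¹ * b * u) - f b u) -
        (f u (u⁻¹ * (a * b) * u) - f (a * b) u) := by
  have hu' : u⁻¹ ∈ S := S.inv_mem hu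
  have hca : u⁻¹ * a * u ∈ S := S.mul_mem (S.mul_mem hu' ha) hu
  have hcb : u⁻¹ * b * u ∈ S := S.mul_mem (S.mul_mem hu' hb) hu
  have h1 := hcoc u hu (u⁻¹ * a * u) hca (u⁻¹ * b * u) hcb
  have h2 := hcoc a ha u hu (u⁻¹ * b * u) hcb
  have h3 := hcoc a ha b hb u hu
  have e1 : u * (u⁻¹ * a * u) = a * u := by group
  have e2 : u⁻¹ * a * u * (u⁻¹ * b * u) = u⁻¹ * (a * b) * u := by group
  have e3 : u * (u⁻¹ * b * u) = b * u := by group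
  rw [e1, e2] at h1
  rw [e3] at h2
  linear_combination h2 - h3 - h1

end Algebra

/-! ### Local constancy from invariance under an open subgroup -/

section Invariance
variable [IsTopologicalGroup Γ]

/-- A function on a subgroup `S` which is invariant under right multiplication by an open subgroup
`N` is locally constant on `S` (cochains of a profinite group factoring through `G/U`, Serre I §2.2,
proof of Prop. 8). [cite: SerreGaloisCohomology1997, I §2.2 Prop. 8] -/
theorem isLocallyConstant_restrict_of_mul_mem_eq {S N : Subgroup Γ} (hN : IsOpen (N : Set Γ))
    {Y : Type w} {φ : Γ → Y} (h : ∀ s ∈ S, ∀ n ∈ N, s * n ∈ S → φ (s * n) = φ s) :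
    IsLocallyConstant (fun s : S => φ s) := by
  refine (IsLocallyConstant.iff_exists_open _).2 fun x => ?_
  refine ⟨Subtype.val ⁻¹' ((x : Γ) • (N : Set Γ)), hN.smul _ |>.preimage continuous_subtype_val,
    ⟨1, N.one_mem, by simp⟩, fun y hy => ?_⟩
  obtain ⟨n, hn, hyn⟩ := hy
  have hy' : (y : Γ) = x * n := by simpa [smul_eq_mul] using hyn.symm
  have := h x x.2 n hn (hy' ▸ y.2)
  rw [← hy'] at this
  exact this

/-- Two-variable version of `isLocallyConstant_restrict_of_mul_mem_eq` (Serre I §2.2, proof of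
Prop. 8). [cite: SerreGaloisCohomology1997, I §2.2 Prop. 8] -/
theorem isLocallyConstant_restrict₂_of_mul_mem_eq {S N : Subgroup Γ} (hN : IsOpen (N : Set Γ))
    {Y : Type w} {F : Γ → Γ → Y}
    (h : ∀ a ∈ S, ∀ b ∈ S, ∀ n₁ ∈ N, ∀ n₂ ∈ N, a * n₁ ∈ S → b * n₂ ∈ S →
      F (a * n₁) (b * n₂) = F a b) :
    IsLocallyConstant (fun p : S × S => F p.1 p.2) := by
  refine (IsLocallyConstant.iff_exists_open _).2 fun x => ?_
  refine ⟨(fun p : S × S => ((p.1 : Γ), (p.2 : Γ))) ⁻¹'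
      (((x.1 : Γ) • (N : Set Γ)) ×ˢ ((x.2 : Γ) • (N : Set Γ))),
    ((hN.smul _).prod (hN.smul _)).preimage (by fun_prop), ?_, fun y hy => ?_⟩
  · exact ⟨⟨1, N.one_mem, by simp⟩, ⟨1, N.one_mem, by simp⟩⟩
  obtain ⟨⟨n₁, hn₁, h₁⟩, ⟨n₂, hn₂, h₂⟩⟩ := hy
  have hy1 : (y.1 : Γ) = x.1 * n₁ := by simpa [smul_eq_mul] using h₁.symm
  have hy2 : (y.2 : Γ) = x.2 * n₂ := by simpa [smul_eq_mul] using h₂.symm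
  have := h x.1 x.1.2 x.2 x.2.2 n₁ hn₁ n₂ hn₂ (hy1 ▸ y.1.2) (hy2 ▸ y.2.2)
  rw [← hy1, ← hy2] at this
  exact this

end Invariance

/-! ### Uniform local constancy on a closed subgroup -/

section Uniform
variable [IsTopologicalGroup Γ] [CompactSpace Γ] [TotallyDisconnectedSpace Γ]

/-- A function locally constant on a CLOSED subgroup `H` of a profinite group is invariant under
`H ∩ N` for some open normal subgroup `N` of the ambient group (continuous cochains with discrete
values factor through a finite quotient, Serre I §2.2, proof of Prop. 8).
[cite: SerreGaloisCohomology1997, I §2.2 Prop. 8] -/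
theorem exists_openNormalSubgroup_restrict_mul_eq {H : Subgroup Γ} (hH : IsClosed (H : Set Γ))
    {Y : Type w} {φ : Γ → Y} (hφ : IsLocallyConstant (fun h : H => φ h)) :
    ∃ N : OpenNormalSubgroup Γ, ∀ a ∈ H, ∀ n ∈ N, n ∈ H → φ (a * n) = φ a := by
  haveI : CompactSpace H := isCompact_iff_compactSpace.mp hH.isCompact
  obtain ⟨NH, hNH⟩ := exists_openNormalSubgroup_forall_mul_eq_of_isLocallyConstant (G := H) hφ
  -- `NH` is open in `H`: it contains `H ∩ U` for an open neighbourhood `U` of `1` in `Γ`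
  have hopen : IsOpen ((NH : Subgroup H) : Set H) := NH.isOpen
  obtain ⟨U, hU, hUeq⟩ := isOpen_induced_iff.mp hopen
  have h1U : (1 : Γ) ∈ U := by
    have : (1 : H) ∈ Subtype.val ⁻¹' U := by rw [hUeq]; exact NH.toSubgroup.one_mem
    exact this
  obtain ⟨N, hN⟩ := ProfiniteGrp.exist_openNormalSubgroup_sub_open_nhds_of_one hU h1U
  refine ⟨N, fun a ha n hn hnH => ?_⟩
  have hmem : (⟨n, hnH⟩ : H) ∈ (NH : Subgroup H) := by
    have : (⟨n, hnH⟩ : H) ∈ Subtype.val ⁻¹' U := hN hn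
    rw [hUeq] at this
    exact this
  exact hNH ⟨a, ha⟩ ⟨n, hnH⟩ hmem

/-- Two-variable version: a function locally constant on `H × H`, `H` closed, is invariant under
`(H ∩ N) × (H ∩ N)` for some open normal `N` (Serre I §2.2, proof of Prop. 8).
[cite: SerreGaloisCohomology1997, I §2.2 Prop. 8] -/
theorem exists_openNormalSubgroup_restrict₂_mul_eq {H : Subgroup Γ} (hH : IsClosed (H : Set Γ))
    {Y : Type w} {F : Γ → Γ → Y} (hF : IsLocallyConstant (fun p : H × H => F p.1 p.2)) :
    ∃ N : OpenNormalSubgroup Γ, ∀ a ∈ H, ∀ b ∈ H, ∀ n₁ ∈ N, ∀ n₂ ∈ N, n₁ ∈ H → n₂ ∈ H →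
      F (a * n₁) (b * n₂) = F a b := by
  haveI : CompactSpace H := isCompact_iff_compactSpace.mp hH.isCompact
  have hF' : IsLocallyConstant (Function.uncurry fun a b : H => F a b) := hF
  obtain ⟨NH, hNH⟩ := exists_openNormalSubgroup_forall_mul_eq_of_isLocallyConstant₂ (G := H) hF'
  have hopen : IsOpen ((NH : Subgroup H) : Set H) := NH.isOpen
  obtain ⟨U, hU, hUeq⟩ := isOpen_induced_iff.mp hopen
  have h1U : (1 : Γ) ∈ U := by
    have : (1 : H) ∈ Subtype.val ⁻¹' U := by rw [hUeq]; exact NH.toSubgroup.one_mem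
    exact this
  obtain ⟨N, hN⟩ := ProfiniteGrp.exist_openNormalSubgroup_sub_open_nhds_of_one hU h1U
  refine ⟨N, fun a ha b hb n₁ hn₁ n₂ hn₂ h₁ h₂ => ?_⟩
  have hmem : ∀ {n : Γ} (hn : n ∈ N) (hnH : n ∈ H), (⟨n, hnH⟩ : H) ∈ (NH : Subgroup H) := by
    intro n hn hnH
    have : (⟨n, hnH⟩ : H) ∈ Subtype.val ⁻¹' U := hN hn
    rw [hUeq] at this
    exact this
  exact hNH ⟨a, ha⟩ ⟨b, hb⟩ ⟨n₁, h₁⟩ (hmem hn₁ h₁) ⟨n₂, h₂⟩ (hmem hn₂ h₂)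

end Uniform

/-! ### Decompositions in `H ⊔ N` -/

section Decomposition

omit [TopologicalSpace Γ] in
/-- Elements of `H ⊔ N`, `N` normal, factor as `h * n`. [folklore] -/
private theorem exists_mul_eq_of_mem_sup {H N : Subgroup Γ} [N.Normal] {g : Γ} (hg : g ∈ H ⊔ N) :
    ∃ h ∈ H, ∃ n ∈ N, g = h * n := by
  have : g ∈ ((H ⊔ N : Subgroup Γ) : Set Γ) := hg
  rw [Subgroup.mul_normal] at this
  obtain ⟨h, hh, n, hn, rfl⟩ := Set.mem_mul.mp this
  exact ⟨h, hh, n, hn, rfl⟩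

omit [TopologicalSpace Γ] in
/-- If `h * n = h' * n'` with `h, h' ∈ H` and `n, n' ∈ N` then `h' = h * m` with `m ∈ H ⊓ N`.
[folklore] -/
private theorem exists_mul_mem_inf_of_mul_eq {H N : Subgroup Γ} {h h' n n' : Γ} (hh : h ∈ H) (hh' : h' ∈ H)
    (hn : n ∈ N) (hn' : n' ∈ N) (he : h * n = h' * n') :
    ∃ m, m ∈ H ∧ m ∈ N ∧ h' = h * m := by
  refine ⟨h⁻¹ * h', H.mul_mem (H.inv_mem hh) hh', ?_, by group⟩
  have : h⁻¹ * h' = n * n'⁻¹ := by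
    calc h⁻¹ * h' = h⁻¹ * (h' * n') * n'⁻¹ := by group
      _ = h⁻¹ * (h * n) * n'⁻¹ := by rw [he]
      _ = n * n'⁻¹ := by group
  rw [this]
  exact N.mul_mem hn (N.inv_mem hn')

end Decomposition

/-! ### `H²` of a closed subgroup as the colimit over its open neighbourhoods -/

section Colimit

variable [IsTopologicalGroup Γ] [CompactSpace Γ] [TotallyDisconnectedSpace Γ]

/-- **Surjectivity half of `H²(H) = colim_{V ⊇ H open} H²(V)`**: a locally constant `2`-cocycle `x` on
a closed subgroup `H` of a profinite group (trivial coefficients) is the restriction of a locally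
constant `2`-cocycle `y` on an open subgroup `V₀ ⊇ H`, which may be taken inside any given open
subgroup `U ⊇ H`.  (`x` is invariant under `H ∩ N` for an open normal `N ≤ U`; put `V₀ = H N` and
`y (h n, h' n') = x (h, h')`.)  Serre, *Galois Cohomology*, I §2.2 Prop. 8.
[cite: SerreGaloisCohomology1997, I §2.2 Prop. 8] -/
theorem exists_open_extension_of_cocycle {H U : Subgroup Γ} (hH : IsClosed (H : Set Γ))
    (hU : IsOpen (U : Set Γ)) (hHU : H ≤ U) {x : Γ → Γ → R}
    (hlc : IsLocallyConstant (fun p : H × H => x p.1 p.2))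
    (hcoc : ∀ a ∈ H, ∀ b ∈ H, ∀ c ∈ H, x a b + x (a * b) c = x b c + x a (b * c)) :
    ∃ V₀ : Subgroup Γ, IsOpen (V₀ : Set Γ) ∧ H ≤ V₀ ∧ V₀ ≤ U ∧
      ∃ y : Γ → Γ → R, IsLocallyConstant (fun p : V₀ × V₀ => y p.1 p.2) ∧
        (∀ a ∈ V₀, ∀ b ∈ V₀, ∀ c ∈ V₀, y a b + y (a * b) c = y b c + y a (b * c)) ∧
        ∀ a ∈ H, ∀ b ∈ H, y a b = x a b := by
  classical
  obtain ⟨N₁, hN₁⟩ := exists_openNormalSubgroup_restrict₂_mul_eq hH hlc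
  obtain ⟨N₂, hN₂⟩ := ProfiniteGrp.exist_openNormalSubgroup_sub_open_nhds_of_one hU U.one_mem
  -- the open normal subgroup `N = N₁ ⊓ N₂ ≤ U`
  set N : Subgroup Γ := (N₁ : Subgroup Γ) ⊓ (N₂ : Subgroup Γ) with hNdef
  haveI hNn : N.Normal := Subgroup.normal_inf_normal _ _
  have hNopen : IsOpen (N : Set Γ) := N₁.isOpen.inter N₂.isOpen
  have hNU : N ≤ U := fun g hg => hN₂ hg.2
  have hN₁' : ∀ a ∈ H, ∀ b ∈ H, ∀ n₁ ∈ N, ∀ n₂ ∈ N, n₁ ∈ H → n₂ ∈ H →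
      x (a * n₁) (b * n₂) = x a b :=
    fun a ha b hb n₁ hn₁ n₂ hn₂ h₁ h₂ => hN₁ a ha b hb n₁ hn₁.1 n₂ hn₂.1 h₁ h₂
  -- `V₀ = H N`
  refine ⟨H ⊔ N, Subgroup.isOpen_mono le_sup_right hNopen, le_sup_left, sup_le hHU hNU, ?_⟩
  have hdec : ∀ g, g ∈ H ⊔ N → ∃ h ∈ H, ∃ n ∈ N, g = h * n := fun g hg => exists_mul_eq_of_mem_sup hg
  choose! φ hφ ψ hψ hφψ using hdec
  -- well-definedness: the `x`-values do not depend on the decomposition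
  have hwd₁ : ∀ a ∈ H ⊔ N, ∀ h ∈ H, ∀ n ∈ N, a = h * n → ∀ k ∈ H, x (φ a) k = x h k := by
    intro a ha h hh n hn he k hk
    obtain ⟨m, hmH, hmN, hm⟩ := exists_mul_mem_inf_of_mul_eq hh (hφ a ha) hn (hψ a ha)
      (he.symm.trans (hφψ a ha))
    rw [hm, ← mul_one k]
    rw [hN₁' h hh k hk m hmN 1 N.one_mem hmH H.one_mem, mul_one]
  have hwd₂ : ∀ a ∈ H ⊔ N, ∀ h ∈ H, ∀ n ∈ N, a = h * n → ∀ k ∈ H, x k (φ a) = x k h := by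
    intro a ha h hh n hn he k hk
    obtain ⟨m, hmH, hmN, hm⟩ := exists_mul_mem_inf_of_mul_eq hh (hφ a ha) hn (hψ a ha)
      (he.symm.trans (hφψ a ha))
    rw [hm, ← mul_one k]
    rw [hN₁' k hk h hh 1 N.one_mem m hmN H.one_mem hmH, mul_one]
  -- products: `φ (a b) ≡ φ a φ b`
  have hmul : ∀ a ∈ H ⊔ N, ∀ b ∈ H ⊔ N, a * b = (φ a * φ b) * ((φ b)⁻¹ * ψ a * φ b * ψ b) := by
    intro a ha b hb
    conv_lhs => rw [hφψ a ha, hφψ b hb]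
    group
  have hmulN : ∀ a ∈ H ⊔ N, ∀ b ∈ H ⊔ N, (φ b)⁻¹ * ψ a * φ b * ψ b ∈ N := by
    intro a ha b hb
    exact N.mul_mem (hNn.conj_mem' _ (hψ a ha) _) (hψ b hb)
  refine ⟨fun a b => x (φ a) (φ b), ?_, ?_, ?_⟩
  · -- locally constant on `V₀ × V₀`: invariant under `N × N`
    refine isLocallyConstant_restrict₂_of_mul_mem_eq (F := fun a b => x (φ a) (φ b)) hNopen
      fun a ha b hb n₁ hn₁ n₂ hn₂ han hbn => ?_
    have e₁ : a * n₁ = φ a * (ψ a * n₁) := by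
      conv_lhs => rw [hφψ a ha]
      exact mul_assoc _ _ _
    have e₂ : b * n₂ = φ b * (ψ b * n₂) := by
      conv_lhs => rw [hφψ b hb]
      exact mul_assoc _ _ _
    rw [hwd₁ (a * n₁) han (φ a) (hφ a ha) (ψ a * n₁) (N.mul_mem (hψ a ha) hn₁) e₁ _ (hφ _ hbn),
      hwd₂ (b * n₂) hbn (φ b) (hφ b hb) (ψ b * n₂) (N.mul_mem (hψ b hb) hn₂) e₂ _ (hφ a ha)]
  · -- the cocycle identity descends from `H`
    intro a ha b hb c hc
    change x (φ a) (φ b) + x (φ (a * b)) (φ c) = x (φ b) (φ c) + x (φ a) (φ (b * c))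
    have hab : a * b ∈ H ⊔ N := (H ⊔ N).mul_mem ha hb
    have hbc : b * c ∈ H ⊔ N := (H ⊔ N).mul_mem hb hc
    rw [hwd₁ (a * b) hab (φ a * φ b) (H.mul_mem (hφ a ha) (hφ b hb)) _ (hmulN a ha b hb)
        (hmul a ha b hb) _ (hφ c hc),
      hwd₂ (b * c) hbc (φ b * φ c) (H.mul_mem (hφ b hb) (hφ c hc)) _ (hmulN b hb c hc)
        (hmul b hb c hc) _ (hφ a ha)]
    exact hcoc _ (hφ a ha) _ (hφ b hb) _ (hφ c hc)
  · -- agreement on `H`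
    intro a ha b hb
    change x (φ a) (φ b) = x a b
    have ha' : a ∈ H ⊔ N := le_sup_left (b := N) ha
    have hb' : b ∈ H ⊔ N := le_sup_left (b := N) hb
    rw [hwd₁ a ha' a ha 1 N.one_mem (mul_one a).symm _ (hφ b hb'),
      hwd₂ b hb' b hb 1 N.one_mem (mul_one b).symm _ ha]

/-- **Injectivity half of `H²(H) = colim_{V ⊇ H open} H²(V)`**: if a locally constant `2`-cochain `f`
on an open subgroup `V` of a profinite group is a coboundary on a closed subgroup `H ≤ V` (of a
cochain locally constant on `H`), then `f` is a coboundary on some open subgroup `V'` with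
`H ≤ V' ≤ V`.  (The bounding cochain `β` is invariant under `H ∩ N`, `f` under `N × N`, for an open
normal `N ≤ V`; extend `β` to `V' = H N` by `β (h n) = β h`.)  Serre, *Galois Cohomology*,
I §2.2 Prop. 8. [cite: SerreGaloisCohomology1997, I §2.2 Prop. 8] -/
theorem exists_open_coboundary_of_coboundary {H V : Subgroup Γ} (hH : IsClosed (H : Set Γ))
    (hV : IsOpen (V : Set Γ)) (hHV : H ≤ V) {f : Γ → Γ → R}
    (hlc : IsLocallyConstant (fun p : V × V => f p.1 p.2))
    (hcob : ∃ β : Γ → R, IsLocallyConstant (fun h : H => β h) ∧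
      ∀ a ∈ H, ∀ b ∈ H, f a b = β a + β b - β (a * b)) :
    ∃ V' : Subgroup Γ, IsOpen (V' : Set Γ) ∧ H ≤ V' ∧ V' ≤ V ∧
      ∃ β : Γ → R, IsLocallyConstant (fun v : V' => β v) ∧
        ∀ a ∈ V', ∀ b ∈ V', f a b = β a + β b - β (a * b) := by
  classical
  obtain ⟨β, hβ, hf⟩ := hcob
  obtain ⟨N₁, hN₁⟩ := exists_openNormalSubgroup_restrict_mul_eq hH hβ
  obtain ⟨N₂, hN₂⟩ := exists_openNormalSubgroup_restrict₂_mul_eq (V.isClosed_of_isOpen hV) hlc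
  obtain ⟨N₃, hN₃⟩ := ProfiniteGrp.exist_openNormalSubgroup_sub_open_nhds_of_one hV V.one_mem
  set N : Subgroup Γ := ((N₁ : Subgroup Γ) ⊓ (N₂ : Subgroup Γ)) ⊓ (N₃ : Subgroup Γ) with hNdef
  haveI hNn : N.Normal := Subgroup.normal_inf_normal _ _
  have hNopen : IsOpen (N : Set Γ) := (N₁.isOpen.inter N₂.isOpen).inter N₃.isOpen
  have hNV : N ≤ V := fun g hg => hN₃ hg.2
  refine ⟨H ⊔ N, Subgroup.isOpen_mono le_sup_right hNopen, le_sup_left, sup_le hHV hNV, ?_⟩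
  have hdec : ∀ g, g ∈ H ⊔ N → ∃ h ∈ H, ∃ n ∈ N, g = h * n := fun g hg => exists_mul_eq_of_mem_sup hg
  choose! φ hφ ψ hψ hφψ using hdec
  -- well-definedness of `β ∘ φ`
  have hwd : ∀ a ∈ H ⊔ N, ∀ h ∈ H, ∀ n ∈ N, a = h * n → β (φ a) = β h := by
    intro a ha h hh n hn he
    obtain ⟨m, hmH, hmN, hm⟩ := exists_mul_mem_inf_of_mul_eq hh (hφ a ha) hn (hψ a ha)
      (he.symm.trans (hφψ a ha))
    rw [hm]
    exact hN₁ h hh m hmN.1.1 hmH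
  refine ⟨fun a => β (φ a), ?_, fun a ha b hb => ?_⟩
  · refine isLocallyConstant_restrict_of_mul_mem_eq (φ := fun a => β (φ a)) hNopen
      fun a ha n hn han => ?_
    have e : a * n = φ a * (ψ a * n) := by
      conv_lhs => rw [hφψ a ha]
      exact mul_assoc _ _ _
    exact hwd (a * n) han (φ a) (hφ a ha) (ψ a * n) (N.mul_mem (hψ a ha) hn) e
  · change f a b = β (φ a) + β (φ b) - β (φ (a * b))
    have hmul : a * b = (φ a * φ b) * ((φ b)⁻¹ * ψ a * φ b * ψ b) := by
      conv_lhs => rw [hφψ a ha, hφψ b hb]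
      group
    have hmulN : (φ b)⁻¹ * ψ a * φ b * ψ b ∈ N := N.mul_mem (hNn.conj_mem' _ (hψ a ha) _) (hψ b hb)
    rw [hwd (a * b) ((H ⊔ N).mul_mem ha hb) (φ a * φ b) (H.mul_mem (hφ a ha) (hφ b hb)) _ hmulN hmul]
    -- `f (φa ψa, φb ψb) = f (φa, φb)` by `N₂`-invariance on `V`
    have hφaV : φ a ∈ V := hHV (hφ a ha)
    have hφbV : φ b ∈ V := hHV (hφ b hb)
    have key : f a b = f (φ a) (φ b) := by
      conv_lhs => rw [hφψ a ha, hφψ b hb]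
      exact hN₂ (φ a) hφaV (φ b) hφbV (ψ a) (hψ a ha).1.2 (ψ b) (hψ b hb).1.2
        (hNV (hψ a ha)) (hNV (hψ b hb))
    rw [key]
    exact hf _ (hφ a ha) _ (hφ b hb)

end Colimit


end Literature.GroupTheory.LocallyConstantCocycles
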